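import Summits.Schanuel.Schanuel.Theorems.ZilberEacGraphCurveEscapeLocal
import HarnessLib

/-!
# Graph base × arbitrary curve, II: escaping zeros of `Q(e^{R(z)}) + E(z)` along a root direction

HONEST FRAMING.  Cell `pub-schanuel` (Zilber's Exponential-Algebraic Closedness, case ladder;
host summit Schanuel), seat 2, gen 16.  The analytic engine of the theorem "graph base of degree
`≥ 2` × ARBITRARY irreducible plane curve has Zariski-dense exponential points"
(`ZilberEacGraphCurveDensity`), an instance class of Mantova–Masser's OPEN density question
(PLMS 2024, §1 p. 5).  NOT Schanuel's conjecture (neither used nor implied; EAC ⇏ SC);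
`EC(3,2)` stays OPEN.

THE ENGINE (`exists_escape_zeros`).  Let `R ∈ ℂ[z]` have degree `d ≥ 2`, let `Q ∈ ℂ[u]` be
non-constant with `Q(0) ≠ 0`, and let `E` be entire with `‖E(z)‖ ≤ C_B e^{δ Re z}` whenever
`Re z ≤ 0` and `|Re R(z)| ≤ B` (a fixed `δ > 0`; a constant `C_B ≥ 0` for every `B`).  Then
`g(z) = Q(e^{R(z)}) + E(z)` has zeros `z_k` with `Re z_k ≤ -L_k`, `‖z_k‖ ≤ 16 L_k + 17`, `L_k → ∞`
— zeros escaping to infinity inside a left sector, linearly.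

Proof.  Take a root `θ ≠ 0` of `Q` and a root direction `ω` of `R` (`a ω^d = ±2πi`,
`Re ω ≤ -‖ω‖/2`; `exists_rootDirection` of `EACDensityAligned`, which needs `d ≥ 2`).  Stage `k`
of seat 1's `exists_alRoot` gives an exact root `z₀` of `R(z₀) = 2πi N_k + log θ` with `‖z₀‖ ≍ k`
and `Re z₀ ≤ -(3/16)(k+1)‖ω‖`; so `e^{R(z₀)} = θ` and `Re R(z₀) = log ‖θ‖`.  In the local
coordinate `z = φ(u) = z₀ e^{u/(dT')}` of `ZilberEacGraphCurveEscapeLocal`,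
`e^{R(φ u)} = θ e^{u + Rem(u)}` with `‖Rem‖ ≤ K/‖z₀‖`, hence
`g(φ(u)) = Q(θ e^{u + Rem(u)}) + E(φ(u)) → h(u) := Q(θ e^{u})` UNIFORMLY on `‖u‖ ≤ 1`
(uniform continuity of `h` on `‖u‖ ≤ 2`; `‖E(φ u)‖ ≤ C e^{δ(Re z₀ + 1)} → 0` because
`|Re R(φ u)| ≤ |log‖θ‖| + 2`).  The limit `h` is entire, `h ≢ 0` (else `Q` would vanish on the
infinite set `θ e^{ℝ}`), `h(0) = 0`; zero persistence (`eventually_exists_zero_of_unif_approx`)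
yields zeros `u_k`, `‖u_k‖ < 1`, of `g ∘ φ` for all large `k`, i.e. zeros `z_k = φ(u_k)` of `g`
within distance `1` of `z₀`.
-/

noncomputable section

open Filter Topology Metric Set Complex Polynomial
open Literature.ModelTheory.Zilber

set_option linter.dupNamespace false

namespace Summit.Schanuel.Schanuel.Theorems

/-! ## Part D. The escaping zeros -/

/-- `Re (N · 2πi) = 0` for an integer `N`. -/
theorem gce_re_intCast_mul_two_pi_I (N : ℤ) : ((N : ℂ) * (2 * Real.pi * I)).re = 0 := by
  simp [Complex.mul_re]

/-- **Escaping zeros of `Q(e^{R(z)}) + E(z)`.**  `R` of degree `≥ 2`; `Q` non-constant with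
`Q(0) ≠ 0`; `E` entire with `‖E(z)‖ ≤ C_B e^{δ Re z}` for `Re z ≤ 0`, `|Re R(z)| ≤ B`.  Then there are
zeros `z_k` of `Q(e^{R(z)}) + E(z)` with `Re z_k ≤ -L_k`, `‖z_k‖ ≤ 16 L_k + 17`, `L_k → ∞`. (new) -/
theorem exists_escape_zeros (R Q : Polynomial ℂ) (hd : 2 ≤ R.natDegree) (hQ0 : Q.eval 0 ≠ 0)
    (hQd : 0 < Q.natDegree) (E : ℂ → ℂ) (hE : Differentiable ℂ E) {δ : ℝ} (hδ : 0 < δ)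
    (hEb : ∀ B : ℝ, ∃ C : ℝ, 0 ≤ C ∧
      ∀ z : ℂ, z.re ≤ 0 → |(R.eval z).re| ≤ B → ‖E z‖ ≤ C * Real.exp (δ * z.re)) :
    ∃ (z : ℕ → ℂ) (L : ℕ → ℝ), Tendsto L atTop atTop ∧
      ∀ k, Q.eval (exp (R.eval (z k))) + E (z k) = 0 ∧ (z k).re ≤ -L k ∧
        ‖z k‖ ≤ 16 * L k + 17 := by
  -- notation and a nonzero root `θ` of `Q`
  set d : ℕ := R.natDegree with hd_def
  set a : ℂ := R.leadingCoeff with ha_def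
  set ℓ : Polynomial ℂ := R.eraseLead with hℓ_def
  have hd0 : d ≠ 0 := by omega
  have hR0 : R ≠ 0 := by
    rintro rfl
    rw [hd_def, Polynomial.natDegree_zero] at hd
    omega
  have ha0 : a ≠ 0 := Polynomial.leadingCoeff_ne_zero.2 hR0
  have hapos : 0 < ‖a‖ := norm_pos_iff.2 ha0
  obtain ⟨θ, hθ⟩ := Complex.exists_root (Polynomial.natDegree_pos_iff_degree_pos.1 hQd)
  have hθ0 : θ ≠ 0 := by
    rintro rfl
    exact hQ0 hθ
  set c₀ : ℂ := Complex.log θ with hc₀_def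
  have hc₀ : exp c₀ = θ := Complex.exp_log hθ0
  -- a root direction
  obtain ⟨ω, s, hs, hω, hre⟩ := exists_rootDirection a ha0 d hd
  have hrhs : (2 * Real.pi * I * s : ℂ) ≠ 0 := by
    have hsC : (s : ℂ) ≠ 0 := by rcases hs with rfl | rfl <;> simp
    have hπ : (Real.pi : ℂ) ≠ 0 := Complex.ofReal_ne_zero.mpr Real.pi_pos.ne'
    simp [hsC, hπ, Complex.I_ne_zero]
  have hω0 : ω ≠ 0 := by
    rintro rfl
    rw [zero_pow (by omega), mul_zero] at hω
    exact hrhs hω.symm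
  have hωpos : 0 < ‖ω‖ := norm_pos_iff.mpr hω0
  -- the limit function `h(u) = Q(θ e^u)`
  set h : ℂ → ℂ := fun u => Q.eval (θ * exp u) with hh_def
  have hh : Differentiable ℂ h :=
    (Polynomial.differentiable Q).comp ((differentiable_const θ).mul differentiable_exp)
  have hh0 : h 0 = 0 := by
    simp only [hh_def, Complex.exp_zero, mul_one]; exact hθ
  have hhne : ∃ u, h u ≠ 0 := by
    by_contra hall
    push Not at hall
    have hinf : Set.Infinite {x : ℂ | Q.IsRoot x} := by
      have hinj : Function.Injective (fun t : ℝ => θ * exp (t : ℂ)) := by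
        intro t₁ t₂ ht
        have h1 : exp (t₁ : ℂ) = exp (t₂ : ℂ) := mul_left_cancel₀ hθ0 ht
        have h2 : Real.exp t₁ = Real.exp t₂ := by
          have := congrArg norm h1
          rwa [Complex.norm_exp, Complex.norm_exp, Complex.ofReal_re, Complex.ofReal_re] at this
        exact Real.exp_injective h2
      have hsub : Set.range (fun t : ℝ => θ * exp (t : ℂ)) ⊆ {x : ℂ | Q.IsRoot x} := by
        rintro _ ⟨t, rfl⟩
        exact hall t
      exact (Set.infinite_range_of_injective hinj).mono hsub
    exact (Polynomial.ne_zero_of_natDegree_gt hQd) (Polynomial.eq_zero_of_infinite_isRoot Q hinf)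
  -- stage sizes and eventual conditions
  set Λ : ℕ → ℝ := fun k => ((k : ℝ) + 1) * ‖ω‖ with hΛ_def
  have hΛ : Tendsto Λ atTop atTop := (tendsto_natCast_add_atTop 1).atTop_mul_const hωpos
  set C₁ : ℝ := coeffNormSum ℓ * (3 * ‖ω‖ + 1) ^ (d - 1) + ‖c₀‖ with hC₁
  have hev₁ : ∀ᶠ k : ℕ in atTop, 32 * C₁ ≤ 2 * Real.pi * ((k : ℝ) + 1) :=
    ((tendsto_natCast_add_atTop 1).const_mul_atTop (by positivity : (0 : ℝ) < 2 * Real.pi)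
      ).eventually_ge_atTop _
  have hev₂ : ∀ᶠ k : ℕ in atTop, 3 ≤ Λ k := hΛ.eventually_ge_atTop 3
  have hev₃ : ∀ᶠ k : ℕ in atTop, 6 ≤ ‖a‖ * Λ k := (hΛ.const_mul_atTop hapos).eventually_ge_atTop 6
  have hev₄ : ∀ᶠ k : ℕ in atTop, 16 ≤ Λ k := hΛ.eventually_ge_atTop 16
  obtain ⟨K₀, hK₀⟩ := eventually_atTop.1 (hev₁.and (hev₂.and (hev₃.and hev₄)))
  -- the roots `z₀(j)` at stage `j + K₀`
  have hroot : ∀ j : ℕ, ∃ z₀ : ℂ, exp (R.eval z₀) = θ ∧ (R.eval z₀).re = Real.log ‖θ‖ ∧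
      1 ≤ ‖z₀‖ ∧ 2 ≤ ‖a‖ * ‖z₀‖ ∧ z₀.re ≤ -(3 / 16) * Λ (j + K₀) ∧
      ‖z₀‖ ≤ 3 * Λ (j + K₀) ∧ z₀.re + 1 ≤ 0 := by
    intro j
    obtain ⟨h1, h2, h3, h4⟩ := hK₀ (j + K₀) (Nat.le_add_left _ _)
    obtain ⟨z₀, hz₀, hup, hlow, hre₀⟩ := exists_alRoot R hd ω s hs hω hre c₀ (j + K₀)
      (by push_cast at h1 ⊢; linarith)
    have hΛk : Λ (j + K₀) = (((j + K₀ : ℕ) : ℝ) + 1) * ‖ω‖ := rfl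
    refine ⟨z₀, ?_, ?_, ?_, ?_, ?_, ?_, ?_⟩
    · rw [hz₀, Complex.exp_add, Complex.exp_int_mul_two_pi_mul_I, one_mul, hc₀]
    · rw [hz₀, Complex.add_re, gce_re_intCast_mul_two_pi_I, zero_add, hc₀_def, Complex.log_re]
    · rw [hΛk] at h2; linarith
    · rw [hΛk] at h3; nlinarith [mul_le_mul_of_nonneg_left hlow hapos.le]
    · rw [hΛk]; linarith
    · rw [hΛk]; linarith
    · rw [hΛk] at h4; linarith
  choose z₀ hz₀θ hz₀re hz₀1 hz₀2 hz₀neg hz₀up hz₀nonpos using hroot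
  -- the remainder constant
  set K : ℝ := 1 / ‖a‖ + coeffNormSum ℓ * ((d - 1 : ℕ) : ℝ) * 2 ^ (d - 1) / ‖a‖ with hK_def
  have hK0 : 0 ≤ K := by have := coeffNormSum_nonneg ℓ; positivity
  -- the local coordinates `φ_j(u) = z₀(j) e^{u/(d T'_j)}` (explicit, no definition)
  set φ : ℕ → ℂ → ℂ := fun j u =>
    z₀ j * exp (u / ((R.natDegree : ℂ) * (R.leadingCoeff * z₀ j ^ R.natDegree))) with hφ_def
  have hRem : ∀ j (u : ℂ), ‖u‖ ≤ 1 → ‖R.eval (φ j u) - R.eval (z₀ j) - u‖ ≤ K / ‖z₀ j‖ :=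
    fun j u hu => norm_gceRem_le hd (hz₀1 j) (hz₀2 j) hu
  have hdisp : ∀ j (u : ℂ), ‖u‖ ≤ 1 → ‖φ j u - z₀ j‖ ≤ 1 := fun j u hu => by
    obtain ⟨h1, h2⟩ := norm_gcePhi_sub_le (R := R) (z₀ := z₀ j) hd (hz₀1 j) (hz₀2 j) hu
    exact h1.trans h2
  have hz₀norm : Tendsto (fun j => ‖z₀ j‖) atTop atTop := by
    refine tendsto_atTop_mono (fun j => ?_)
      ((hΛ.comp (tendsto_add_atTop_nat K₀)).const_mul_atTop (by norm_num : (0 : ℝ) < 3 / 16))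
    have h1 := hz₀neg j
    have h2 := abs_re_le_norm (z₀ j)
    have h3 : -(z₀ j).re ≤ |(z₀ j).re| := neg_le_abs _
    simp only [Function.comp_apply]
    linarith
  -- the rescaled functions `G_j(u) = g(φ_j(u))`
  set G : ℕ → ℂ → ℂ := fun j u => Q.eval (exp (R.eval (φ j u))) + E (φ j u) with hG_def
  have hGdiff : ∀ j, Differentiable ℂ (G j) := by
    intro j
    have hφ : Differentiable ℂ (φ j) := differentiable_gcePhi R (z₀ j)
    exact ((Polynomial.differentiable Q).comp (((Polynomial.differentiable R).comp hφ).cexp)).add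
      (hE.comp hφ)
  -- the key identity `e^{R(φ u)} = θ e^{u + Rem u}`, `Rem u = R(φ u) - R(z₀) - u`
  have hkey : ∀ j (u : ℂ), exp (R.eval (φ j u)) =
      θ * exp (u + (R.eval (φ j u) - R.eval (z₀ j) - u)) := by
    intro j u
    rw [← hz₀θ j, ← Complex.exp_add]
    congr 1
    ring
  -- uniform approximation on `closedBall 0 1`
  obtain ⟨C, hC0, hC⟩ := hEb (|Real.log ‖θ‖| + 2)
  have hunif : ∀ η : ℝ, 0 < η → ∀ᶠ j in atTop, ∀ u ∈ closedBall (0 : ℂ) 1, ‖G j u - h u‖ < η := by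
    intro η hη
    -- uniform continuity of `h` on `closedBall 0 2`
    obtain ⟨β, hβ, hβh⟩ := Metric.uniformContinuousOn_iff.1
      ((isCompact_closedBall (0 : ℂ) 2).uniformContinuousOn_of_continuous hh.continuous.continuousOn)
      (η / 2) (half_pos hη)
    -- eventually the remainder is `< min β 1` and the error term `< η/2`
    have hevR : ∀ᶠ j in atTop, K / ‖z₀ j‖ < min β 1 :=
      (tendsto_const_nhds.div_atTop hz₀norm).eventually (gt_mem_nhds (lt_min hβ zero_lt_one))
    have hevE : ∀ᶠ j in atTop, C * Real.exp (δ * (1 - (3 / 16) * Λ (j + K₀))) < η / 2 := by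
      have h1 : Tendsto (fun j => δ * (1 - (3 / 16) * Λ (j + K₀))) atTop atBot := by
        have h2 : Tendsto (fun j => 1 + -((3 / 16) * Λ (j + K₀))) atTop atBot :=
          tendsto_atBot_add_const_left _ 1 (tendsto_neg_atTop_atBot.comp
            ((hΛ.comp (tendsto_add_atTop_nat K₀)).const_mul_atTop (by norm_num : (0:ℝ) < 3 / 16)))
        have h2' : Tendsto (fun j => 1 - (3 / 16) * Λ (j + K₀)) atTop atBot :=
          h2.congr fun j => by ring
        exact h2'.const_mul_atBot hδ
      have h3 : Tendsto (fun j => C * Real.exp (δ * (1 - (3 / 16) * Λ (j + K₀)))) atTop (𝓝 (C * 0)) :=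
        (Real.tendsto_exp_atBot.comp h1).const_mul C
      rw [mul_zero] at h3
      exact h3.eventually (gt_mem_nhds (half_pos hη))
    filter_upwards [hevR, hevE] with j hjR hjE u hu
    rw [mem_closedBall, dist_zero_right] at hu
    set ρ : ℂ := R.eval (φ j u) - R.eval (z₀ j) - u with hρ_def
    have hRem1 : ‖ρ‖ < min β 1 := (hRem j u hu).trans_lt hjR
    have hRemβ : ‖ρ‖ < β := hRem1.trans_le (min_le_left _ _)
    have hRem1' : ‖ρ‖ ≤ 1 := (hRem1.trans_le (min_le_right _ _)).le
    -- the `Q`-term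
    have hQterm : ‖Q.eval (exp (R.eval (φ j u))) - h u‖ < η / 2 := by
      rw [hkey]
      have hmem1 : u + ρ ∈ closedBall (0 : ℂ) 2 := by
        rw [mem_closedBall, dist_zero_right]
        exact (norm_add_le _ _).trans (by linarith)
      have hmem2 : u ∈ closedBall (0 : ℂ) 2 := by
        rw [mem_closedBall, dist_zero_right]; linarith
      have hdist : dist (u + ρ) u < β := by
        rw [dist_eq_norm, add_sub_cancel_left]; exact hRemβ
      have := hβh _ hmem1 _ hmem2 hdist
      rwa [dist_eq_norm] at this
    -- the `E`-term
    have hEterm : ‖E (φ j u)‖ < η / 2 := by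
      have hre1 : (φ j u).re ≤ (z₀ j).re + 1 := by
        have h1 := re_le_norm (φ j u - z₀ j)
        rw [Complex.sub_re] at h1
        linarith [hdisp j u hu]
      have hre0 : (φ j u).re ≤ 0 := hre1.trans (hz₀nonpos j)
      have hReR : |(R.eval (φ j u)).re| ≤ |Real.log ‖θ‖| + 2 := by
        have e1 : (R.eval (φ j u)).re = Real.log ‖θ‖ + (u.re + ρ.re) := by
          rw [← hz₀re j, ← Complex.add_re, ← Complex.add_re]
          congr 1
          rw [hρ_def]; ring
        rw [e1]
        have h1 := abs_re_le_norm u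
        have h2 := abs_re_le_norm ρ
        have h3 := abs_add_le (Real.log ‖θ‖) (u.re + ρ.re)
        have h4 := abs_add_le u.re ρ.re
        linarith
      have h5 := hC _ hre0 hReR
      refine h5.trans_lt (lt_of_le_of_lt ?_ hjE)
      refine mul_le_mul_of_nonneg_left (Real.exp_le_exp.2 ?_) hC0
      refine mul_le_mul_of_nonneg_left ?_ hδ.le
      linarith [hz₀neg j]
    calc ‖G j u - h u‖ = ‖(Q.eval (exp (R.eval (φ j u))) - h u) + E (φ j u)‖ := by
          rw [hG_def]; ring_nf
      _ ≤ ‖Q.eval (exp (R.eval (φ j u))) - h u‖ + ‖E (φ j u)‖ :=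
          norm_add_le _ _
      _ < η / 2 + η / 2 := add_lt_add hQterm hEterm
      _ = η := by ring
  -- persistence: zeros of `G_j` in `ball 0 1` for all large `j`
  have hzeros := eventually_exists_zero_of_unif_approx hh hhne hh0 hGdiff zero_lt_one hunif
  obtain ⟨K₁, hK₁⟩ := eventually_atTop.1 hzeros
  have hsol : ∀ k : ℕ, ∃ u : ℂ, ‖u‖ ≤ 1 ∧ G (k + K₁) u = 0 := by
    intro k
    obtain ⟨u, hu, hu0⟩ := hK₁ (k + K₁) (Nat.le_add_left _ _)
    rw [mem_ball, dist_zero_right] at hu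
    exact ⟨u, hu.le, hu0⟩
  choose u hu1 hu0 using hsol
  -- the zeros and their bookkeeping
  refine ⟨fun k => φ (k + K₁) (u k), fun k => (3 / 16) * Λ (k + K₁ + K₀) - 1,
    ?_, fun k => ⟨?_, ?_, ?_⟩⟩
  · refine tendsto_atTop_add_const_right _ (-1) ?_
    have : Tendsto (fun k => Λ (k + K₁ + K₀)) atTop atTop := by
      have h1 := hΛ.comp (tendsto_add_atTop_nat (K₁ + K₀))
      refine h1.congr fun k => ?_
      simp only [Function.comp_apply, add_assoc]
    exact this.const_mul_atTop (by norm_num : (0 : ℝ) < 3 / 16)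
  · exact hu0 k
  · have h1 := re_le_norm (φ (k + K₁) (u k) - z₀ (k + K₁))
    rw [Complex.sub_re] at h1
    have h2 := hdisp (k + K₁) (u k) (hu1 k)
    have h3 := hz₀neg (k + K₁)
    linarith
  · have h1 := norm_le_insert' (φ (k + K₁) (u k)) (z₀ (k + K₁))
    have h2 := hdisp (k + K₁) (u k) (hu1 k)
    have h3 := hz₀up (k + K₁)
    linarith

end Summit.Schanuel.Schanuel.Theorems
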